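import Summits.QuantumFields.YangMills.Theorems.BalabanUVNodesN11TopPairQuadSlotK1Hypotheses

/-!
# DAG node N11 — THE `ζ0`-VALUE DIAL AT THE TOP PAIR: with `quad` LEFT UNTOUCHED (pinned or not, honest or not), the VALUE of the residual factor `ζ_0(∅)` — free in `[0, 1]` under the
# rows `ζ0 ≥ 0`, `Σ_Y ζ0 = 1`, two-scale locality — serves the top-pair clause of the first 𝐓-law by itself: `ζ_0(∅)(ω) := 𝐓ρ₀(𝕋,𝕋)(V_1)·e^{½quad_0(𝕋)(base₁V_1)}·e^{−A_1(s′)(U_1V_1)}`, the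
# complementary mass on a spare region; OLD SIDE = NEW SIDE identically, rows transferred under ONE range inequality (`value ≤ 1`, which the free constant `E_1` of (2.23) buys).  So a law on
# `quad` alone (the companion's (q1)) does NOT make the top pair contentful: the VALUES of `ζ0` must be pinned too (K0b's (3.2)·(3.3) products) (count-neutral, LOCATED; nothing of Bałaban)

HEADER — WORK-UNIT METADATA.  Cell `pub-ymgap`, YM-PLAN Track A (HUMAN RULING D-0062), seat `pub-ymgap-dag-n11-d` (g34; N11 [B14], s2), route `BalabanUVNodes`, item K1⁹ =
stmt-QuantumFields-27364 (helper lane, `--kind proof --supports 27364 --as helper`, count-neutral).  [III] = [Balaban1988Convergent], [I] = [Balaban1987RG1].  Over this seat's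
`…N11TopPairQuadSlot` ∕ `…K1Hypotheses` (g34: the `quad` dial; `seq_top_unique`, `slotsTOfRecord_nonneg_of_provisos₁₃CoPH`, the `sameR` transports), g33's `…N11TopPairAtNewFieldShape`
(`sect2Slot_top_pair_eq_of_newFieldShape`: new side `= g ∅ V′ · e^{−½quad_0(𝕋)(base₁V′)} · e^{A_1}`), RECORD 13 v1.7∕v1.8 `H`; RR-2 g21's type-owner reading (bus 2026-08-29T15:20:20Z: (q1) = a
row `(ω j).2 = 0 → quad j Λ′ ω = 0` on `TkResidualW.Laws`).

WHY ∕ WHAT.  The companion's fiat dials `quad`; RR-2 costed the row (q1) that forbids that dial.  This file shows (q1) is NOT ENOUGH even at the top pair: the rows constrain `ζ0`'s SIGN,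
NORMALISATION and LOCALITY, not its VALUES, and a sub-unit value is a downward dial.  §1 ★★ `slotsT_top_pair_eq_sect2Slot_of_value` (profile value `g ∅ V = 𝐓ρ₀(𝕋,𝕋)(V)·e^{½quad_0(𝕋)(base₁V)}·
e^{−A_1(s′)(U_1V)}` ⇒ old side `=` new side AT EVERY `V`, whatever `quad` is — no switch, no support condition) · `top_O3_clause_of_value`.  §2 ★ rows: `zhLocal_of_valueRepin` (unconditional) ·
`zhUnity_of_valueRepin` (unconditional: `g + (1 − g) = 1`) · `zhLaws_of_valueRepin` (⟸ `0 ≤ value ≤ 1`) · ★★★★ `exists_zh_top_pair_identity_by_value` (next to every `θ`, `quad` and every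
non-top history UNCHANGED: the identity at every top history of length `1` and every `V`; `zhLocal`, `ZhUnity` transferred outright, `zhLaws` under the range inequality
`0 ≤ 𝐓ρ₀(𝕋,𝕋)(V)·e^{½quad}·e^{−A_1} ≤ 1`) · ★★★★★ `exists_zh_top_pair_identity_by_value_of_hypotheses` (inside K1⁹'s hypothesis class: `ZhUnity` ∕ `SlotsNondegenerate₁₃` ∕ `Admissible` outright, `Provisos₁₃SepCoPH` given the range inequality).  READING (type owners ∕
director's column, next to RR-2's LOCATED-QUAD): the top-pair conjunct is contentful only once BOTH residual slots carry VALUE pins — `quad` (C2) AND `ζ0` (K0b's {0,1}-valued (3.2)·(3.3)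
products; a row «`ζ0 ∈ {0, 1}`» would kill this dial) — and the constant `E_k` of (2.23) is tied down; (q1) alone buys nothing here.

HONEST FRAMING.  A READING on the tree's own rows and objects (count-neutral, LOCATED): nothing of Bałaban asserted or refuted; the value profile is NOT print's `ζ`; the range inequality is
NOT claimed at any `θ` (it is DISPLAYED; print's free constant `E_1` enters `A_1` additively, (2.23)); K1⁹'s `∃θ` NOT advanced and NOT refuted; no `Stage13HParams` of record constructed or
modified; N11 NOT discharged; K1⁹ NOT closed; no registered stub touched; counts unmoved (typed 28∕28 · discharged 8∕27).  One finite four-torus programme at fixed `ε = L^{−K}`; NOT ℝ⁴, NOT OS,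
NOT a mass gap, NOT Clay.  No `sorry`, `axiom`, `def`, `instance`, `notation`.  Sources (SHAPE only): [III] Thm 1 p.262, (2.18) p.257, (2.21)–(2.23) p.258, (3.2) p.265, p.267, (3.16)–(3.20)
pp.268–269, (3.25) p.270; [I] Thm 1 p.259, (0.22)–(0.25) pp.256–257.
-/

noncomputable section

open MeasureTheory
open scoped BigOperators Matrix.Norms.L2Operator

namespace Summit.QuantumFields.YangMills.Theorems.BalabanUVNodesN11TopPairZetaValueDial

open Literature.MathematicalPhysics.QuantumFieldTheory.Balaban1983to89 T4Continuum Node00 Node00.Tk B14.Eq218Concrete B14.Sect3Decomp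
open BalabanUVNodesN11TopPairAtNewFieldShape (sect2Slot_top_pair_eq_of_newFieldShape)
open BalabanUVNodesN11TopPairQuadSlot (seq_top_unique slotsTOfRecord_nonneg_of_provisos₁₃CoPH)
open BalabanUVNodesN11TopPairQuadSlotK1Hypotheses (provisos₁₃SepCoPH_of_sameR slotsNondegenerate₁₃_of_sameR admissible_of_sameR)

variable {F : T4Family} {N : ℕ} [NeZero N]

/-! ## §1. The value dial: old side = new side at every coarse field, whatever `quad` is -/

section Value

variable (θ : Stage13HParams F N) (p : B12.RunParams)

/-- ★★ **THE VALUE DIAL AT THE TOP PAIR** (any terms `(u₁, e₁)`, ANY `quad`): if the generation-`0` residual factor has the new-field shape with the profile VALUE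
`g ∅ V = 𝐓ρ₀(𝕋,𝕋)(V) · e^{½quad_0(𝕋)(base₁V)} · e^{−A_1(s′; u₁, (∅,0), e₁)(U_1 V)}`, then OLD SIDE = NEW SIDE at every `V`: `𝐓ρ₀(𝕋,𝕋)(V) = sect2Slot(W^θ(s′), s′, u₁, e₁, U_1)(V)`
(`T·e^{q∕2}·e^{−a}·e^{−q∕2}·e^{a} = T`).  No switch, no support condition, no law on `quad` helps. [cite: Balaban1988Convergent, (2.18) p.257, (2.21)–(2.23) p.258, p.267, (3.25) p.270 (bookkeeping)] -/
theorem slotsT_top_pair_eq_sect2Slot_of_value (s' : SeqOfRecord F θ.ν θ.τ9.M (gOfRecord₁₃ F N θ.toStage13Params p) p.K 1) (hΩ : s'.Ω 1 = Set.univ) (hΛ : s'.Λ 1 = Set.univ)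
    (u₁ : Sect2.TermValues (F.P p.K) (MatA N) (FluctV N) θ.τ9.M) (e₁ : ℝ)
    {g : Set (Site (F.P p.K) 0) → GaugeField (F.P p.K) 1 (SU N) → ℝ} (hζ : ∀ Y ω, (θ.Zh p 1 s'.Ω s'.Λ).ζ0 0 Y ω = g Y (ω 1).1) (V : GaugeField (F.P p.K) 1 (SU N))
    (hval : g ∅ V = slotsTOfRecord F N θ.ν θ.τ9 (EOfRecord₁₃ F N θ.toStage13Params) (wOfRecord₉ F N θ.toStage9Params) θ.ppSel p (gOfRecord₁₃ F N θ.toStage13Params p) 1 s' V *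
        Real.exp ((1 / 2 : ℝ) * (θ.Zh p 1 s'.Ω s'.Λ).quad 0 Set.univ (baseCfg (V := FluctV N) 1 V)) *
        Real.exp (-(sect2ActionDataOfRecord F N (FluctV N) p.K (settingOfRecord₁₃ F N θ.toStage13Params p) (θ.rzAt p s') s' u₁ (fun _ => ∅, fun _ => 0) e₁).action23 1
          (UbgOfRecord₁₃CoP F N θ.toStage13Params p 1 s' (fun j => ((baseCfg (V := FluctV N) 1 V) j).1)))) :
    slotsTOfRecord F N θ.ν θ.τ9 (EOfRecord₁₃ F N θ.toStage13Params) (wOfRecord₉ F N θ.toStage9Params) θ.ppSel p (gOfRecord₁₃ F N θ.toStage13Params p) 1 s' V =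
      sect2Slot F N (FluctV N) p.K (settingOfRecord₁₃ F N θ.toStage13Params p) (θ.rzAt p s') (WtOfRecord₁₃H F N θ p s') s' u₁ e₁
        (UbgOfRecord₁₃CoP F N θ.toStage13Params p 1 s') V := by
  rw [sect2Slot_top_pair_eq_of_newFieldShape θ p s' hζ hΩ hΛ _ _ u₁ e₁ _ V, hval]
  set T := slotsTOfRecord F N θ.ν θ.τ9 (EOfRecord₁₃ F N θ.toStage13Params) (wOfRecord₉ F N θ.toStage9Params) θ.ppSel p (gOfRecord₁₃ F N θ.toStage13Params p) 1 s' V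
  set q := (θ.Zh p 1 s'.Ω s'.Λ).quad 0 Set.univ (baseCfg (V := FluctV N) 1 V)
  set a := (sect2ActionDataOfRecord F N (FluctV N) p.K (settingOfRecord₁₃ F N θ.toStage13Params p) (θ.rzAt p s') s' u₁ (fun _ => ∅, fun _ => 0) e₁).action23 1
    (UbgOfRecord₁₃CoP F N θ.toStage13Params p 1 s' (fun j => ((baseCfg (V := FluctV N) 1 V) j).1))
  have h : Real.exp ((1 / 2 : ℝ) * q) * Real.exp (-a) * Real.exp (-(1 / 2 : ℝ) * q) * Real.exp a = 1 := by
    rw [← Real.exp_add, ← Real.exp_add, ← Real.exp_add, show (1 / 2 : ℝ) * q + -a + -(1 / 2 : ℝ) * q + a = 0 by ring, Real.exp_zero]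
  calc T = T * (Real.exp ((1 / 2 : ℝ) * q) * Real.exp (-a) * Real.exp (-(1 / 2 : ℝ) * q) * Real.exp a) := by rw [h, mul_one]
    _ = T * Real.exp ((1 / 2 : ℝ) * q) * Real.exp (-a) * Real.exp (-(1 / 2 : ℝ) * q) * Real.exp a := by ring

/-- ★★ **HENCE THE (O3′) CLAUSE OF THE TOP PAIR HOLDS** at every such `θ`, for the prescribed terms — the identity holds at EVERY `V`. [cite: Balaban1988Convergent, Thm 1 p.262, (2.18) p.257, (3.25) p.270 (bookkeeping)] -/
theorem top_O3_clause_of_value (s' : SeqOfRecord F θ.ν θ.τ9.M (gOfRecord₁₃ F N θ.toStage13Params p) p.K 1) (hΩ : s'.Ω 1 = Set.univ) (hΛ : s'.Λ 1 = Set.univ)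
    (u₁ : Sect2.TermValues (F.P p.K) (MatA N) (FluctV N) θ.τ9.M) (e₁ : ℝ)
    {g : Set (Site (F.P p.K) 0) → GaugeField (F.P p.K) 1 (SU N) → ℝ} (hζ : ∀ Y ω, (θ.Zh p 1 s'.Ω s'.Λ).ζ0 0 Y ω = g Y (ω 1).1)
    (hval : ∀ V, g ∅ V = slotsTOfRecord F N θ.ν θ.τ9 (EOfRecord₁₃ F N θ.toStage13Params) (wOfRecord₉ F N θ.toStage9Params) θ.ppSel p (gOfRecord₁₃ F N θ.toStage13Params p) 1 s' V *
        Real.exp ((1 / 2 : ℝ) * (θ.Zh p 1 s'.Ω s'.Λ).quad 0 Set.univ (baseCfg (V := FluctV N) 1 V)) *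
        Real.exp (-(sect2ActionDataOfRecord F N (FluctV N) p.K (settingOfRecord₁₃ F N θ.toStage13Params p) (θ.rzAt p s') s' u₁ (fun _ => ∅, fun _ => 0) e₁).action23 1
          (UbgOfRecord₁₃CoP F N θ.toStage13Params p 1 s' (fun j => ((baseCfg (V := FluctV N) 1 V) j).1)))) :
    slotsTOfRecord F N θ.ν θ.τ9 (EOfRecord₁₃ F N θ.toStage13Params) (wOfRecord₉ F N θ.toStage9Params) θ.ppSel p (gOfRecord₁₃ F N θ.toStage13Params p) 1 s' = 0 ∨
      ∀ᵐ V ∂fieldMeasure (F.P p.K) 1 (SU N),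
        chiSeqOfRecord F N θ.ν θ.τ9.M (gOfRecord₁₃ F N θ.toStage13Params p) p.K 1 s' V ≠ 0 →
          slotsTOfRecord F N θ.ν θ.τ9 (EOfRecord₁₃ F N θ.toStage13Params) (wOfRecord₉ F N θ.toStage9Params) θ.ppSel p (gOfRecord₁₃ F N θ.toStage13Params p) 1 s' V =
            sect2Slot F N (FluctV N) p.K (settingOfRecord₁₃ F N θ.toStage13Params p) (θ.rzAt p s') (WtOfRecord₁₃H F N θ p s') s' u₁ e₁
              (UbgOfRecord₁₃CoP F N θ.toStage13Params p 1 s') V :=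
  Or.inr (Filter.Eventually.of_forall fun V _ => slotsT_top_pair_eq_sect2Slot_of_value θ p s' hΩ hΛ u₁ e₁ hζ V (hval V))

end Value

/-! ## §2. The value re-pin (spare mass on `Y = 𝕋`) is inhabited next to every `θ` with `quad` untouched; `zhLocal`, `ZhUnity` transfer outright, `zhLaws` under the range inequality -/

section Inhabited

variable {θ θ' : Stage13HParams F N} {v : (p : B12.RunParams) → GaugeField (F.P p.K) 1 (SU N) → ℝ}

/-- ★ The row `zhLocal` transfers to the value re-pin (the new generation-`0` factor reads `(ω 1).1` only). [cite: Balaban1988Convergent, (3.1) p.264, (3.2)–(3.4) p.265, p.267] -/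
theorem zhLocal_of_valueRepin (hoff : ∀ p n Ω Λ, ¬ (n = 1 ∧ Ω 1 = Set.univ ∧ Λ 1 = Set.univ) → θ'.Zh p n Ω Λ = θ.Zh p n Ω Λ)
    (hS : ∀ p n Ω Λ j Y ω, (θ'.Zh p n Ω Λ).ζ0 (j + 1) Y ω = (θ.Zh p n Ω Λ).ζ0 (j + 1) Y ω)
    (h0 : ∀ p n Ω Λ, (n = 1 ∧ Ω 1 = Set.univ ∧ Λ 1 = Set.univ) → ∀ Y ω, (θ'.Zh p n Ω Λ).ζ0 0 Y ω =
      Set.indicator {∅} (fun _ => v p (ω 1).1) Y + Set.indicator {Set.univ} (fun _ => 1 - v p (ω 1).1) Y)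
    (hloc : ∀ p n Ω Λ, (θ.Zh p n Ω Λ).LocalLaws) : ∀ p n Ω Λ, (θ'.Zh p n Ω Λ).LocalLaws := by
  intro p n Ω Λ
  by_cases htop : n = 1 ∧ Ω 1 = Set.univ ∧ Λ 1 = Set.univ
  · refine ⟨fun j Y ω ω' hj hj1 => ?_⟩
    rcases j with _ | j
    · rw [h0 p n Ω Λ htop, h0 p n Ω Λ htop, hj1]
    · rw [hS, hS]
      exact (hloc p n Ω Λ).zeta0_local (j + 1) Y ω ω' hj hj1
  · rw [hoff p n Ω Λ htop]
    exact hloc p n Ω Λ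

/-- ★ The guard `ZhUnity` transfers to the value re-pin UNCONDITIONALLY: `v + (1 − v) = 1` (the spare region `𝕋 ≠ ∅` carries the complementary mass, of either sign).
[cite: Balaban1988Convergent, (3.16)–(3.20) pp.268–269] -/
theorem zhUnity_of_valueRepin (hoff : ∀ p n Ω Λ, ¬ (n = 1 ∧ Ω 1 = Set.univ ∧ Λ 1 = Set.univ) → θ'.Zh p n Ω Λ = θ.Zh p n Ω Λ)
    (hS : ∀ p n Ω Λ j Y ω, (θ'.Zh p n Ω Λ).ζ0 (j + 1) Y ω = (θ.Zh p n Ω Λ).ζ0 (j + 1) Y ω)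
    (h0 : ∀ p n Ω Λ, (n = 1 ∧ Ω 1 = Set.univ ∧ Λ 1 = Set.univ) → ∀ Y ω, (θ'.Zh p n Ω Λ).ζ0 0 Y ω =
      Set.indicator {∅} (fun _ => v p (ω 1).1) Y + Set.indicator {Set.univ} (fun _ => 1 - v p (ω 1).1) Y)
    (hU : θ.ZhUnity) : θ'.ZhUnity := by
  intro p n Ω Λ j ω
  by_cases htop : n = 1 ∧ Ω 1 = Set.univ ∧ Λ 1 = Set.univ
  · rcases j with _ | j
    · simp_rw [h0 p n Ω Λ htop]
      rw [finsum_add_distrib (Set.toFinite _) (Set.toFinite _),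
        finsum_eq_single _ (∅ : Set (Site (F.P p.K) 0)) (fun Y hY => Set.indicator_of_notMem (by simpa using hY) _),
        finsum_eq_single _ (Set.univ : Set (Site (F.P p.K) 0)) (fun Y hY => Set.indicator_of_notMem (by simpa using hY) _),
        Set.indicator_of_mem (Set.mem_singleton _), Set.indicator_of_mem (Set.mem_singleton _)]
      ring
    · simp_rw [hS]
      exact hU p n Ω Λ (j + 1) ω
  · simp_rw [hoff p n Ω Λ htop]
    exact hU p n Ω Λ j ω

/-- ★ The row `zhLaws` (`ζ0 ≥ 0`) transfers to the value re-pin UNDER THE RANGE INEQUALITY `0 ≤ v ≤ 1`. [cite: Balaban1988Convergent, p.267 (bookkeeping)] -/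
theorem zhLaws_of_valueRepin (hoff : ∀ p n Ω Λ, ¬ (n = 1 ∧ Ω 1 = Set.univ ∧ Λ 1 = Set.univ) → θ'.Zh p n Ω Λ = θ.Zh p n Ω Λ)
    (hS : ∀ p n Ω Λ j Y ω, (θ'.Zh p n Ω Λ).ζ0 (j + 1) Y ω = (θ.Zh p n Ω Λ).ζ0 (j + 1) Y ω)
    (h0 : ∀ p n Ω Λ, (n = 1 ∧ Ω 1 = Set.univ ∧ Λ 1 = Set.univ) → ∀ Y ω, (θ'.Zh p n Ω Λ).ζ0 0 Y ω =
      Set.indicator {∅} (fun _ => v p (ω 1).1) Y + Set.indicator {Set.univ} (fun _ => 1 - v p (ω 1).1) Y)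
    (hv : ∀ p V, 0 ≤ v p V ∧ v p V ≤ 1) (hlaws : ∀ p n Ω Λ, (θ.Zh p n Ω Λ).Laws) : ∀ p n Ω Λ, (θ'.Zh p n Ω Λ).Laws := by
  intro p n Ω Λ
  by_cases htop : n = 1 ∧ Ω 1 = Set.univ ∧ Λ 1 = Set.univ
  · refine ⟨fun j Y ω => ?_⟩
    rcases j with _ | j
    · rw [h0 p n Ω Λ htop]
      exact add_nonneg (Set.indicator_nonneg (fun _ _ => (hv p _).1) Y) (Set.indicator_nonneg (fun _ _ => sub_nonneg.2 (hv p _).2) Y)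
    · rw [hS]
      exact (hlaws p n Ω Λ).zeta0_nonneg (j + 1) Y ω
  · rw [hoff p n Ω Λ htop]
    exact hlaws p n Ω Λ

/-- ★★★★ **HEADLINE — THE TOP-PAIR CLAUSE SERVED BY THE VALUE OF `ζ0` ALONE, `quad` UNTOUCHED**: next to every `θ`, for any prescribed terms `(u_p, e_p)`, a parameter `θ′` with the SAME
`Stage13RParams` data, `Phih` AND `quad` (every generation, every history), the same residual at every non-top history, generations `≥ 1` unchanged, whose generation-`0` factor at the top
histories of length `1` is the VALUE profile `v_p(V_1)` on `Y = ∅` and `1 − v_p(V_1)` on the spare region `Y = 𝕋` with `v_p(V) = 𝐓ρ₀(𝕋,𝕋)(V)·e^{½quad_0(𝕋)(base₁V)}·e^{−A_1(s′;u_p,e_p)(U_1V)}`: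
at `θ′`, `𝐓ρ₀(𝕋,𝕋)(V) = sect2Slot(W^{θ′}(s′), s′, u_p, e_p, U_1)(V)` at EVERY `V`; `zhLocal` and `ZhUnity` transfer outright; `zhLaws` transfers under the range inequality `0 ≤ v_p ≤ 1`.
[cite: Balaban1988Convergent, Thm 1 p.262, (2.18) p.257, (2.21)–(2.23) p.258, (3.2) p.265, p.267, (3.16)–(3.20) pp.268–269, (3.25) p.270] -/
theorem exists_zh_top_pair_identity_by_value (θ : Stage13HParams F N)
    (u : (p : B12.RunParams) → (M : ℕ) → Sect2.TermValues (F.P p.K) (MatA N) (FluctV N) M) (e : B12.RunParams → ℝ) :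
    ∃ (v : (p : B12.RunParams) → GaugeField (F.P p.K) 1 (SU N) → ℝ) (θ' : Stage13HParams F N), θ'.toStage13RParams = θ.toStage13RParams ∧ θ'.Phih = θ.Phih ∧
      (∀ p n Ω Λ, ¬ (n = 1 ∧ Ω 1 = Set.univ ∧ Λ 1 = Set.univ) → θ'.Zh p n Ω Λ = θ.Zh p n Ω Λ) ∧
      (∀ p n Ω Λ j Λ' ω, (θ'.Zh p n Ω Λ).quad j Λ' ω = (θ.Zh p n Ω Λ).quad j Λ' ω) ∧
      ((∀ p n Ω Λ, (θ.Zh p n Ω Λ).LocalLaws) → ∀ p n Ω Λ, (θ'.Zh p n Ω Λ).LocalLaws) ∧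
      (θ.ZhUnity → θ'.ZhUnity) ∧
      ((∀ p V, 0 ≤ v p V ∧ v p V ≤ 1) → (∀ p n Ω Λ, (θ.Zh p n Ω Λ).Laws) → ∀ p n Ω Λ, (θ'.Zh p n Ω Λ).Laws) ∧
      (∀ (p : B12.RunParams) (s' : SeqOfRecord F θ.ν θ.τ9.M (gOfRecord₁₃ F N θ.toStage13Params p) p.K 1), s'.Ω 1 = Set.univ → s'.Λ 1 = Set.univ → ∀ V : GaugeField (F.P p.K) 1 (SU N),
        v p V = slotsTOfRecord F N θ.ν θ.τ9 (EOfRecord₁₃ F N θ.toStage13Params) (wOfRecord₉ F N θ.toStage9Params) θ.ppSel p (gOfRecord₁₃ F N θ.toStage13Params p) 1 s' V *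
          Real.exp ((1 / 2 : ℝ) * (θ.Zh p 1 s'.Ω s'.Λ).quad 0 Set.univ (baseCfg (V := FluctV N) 1 V)) *
          Real.exp (-(sect2ActionDataOfRecord F N (FluctV N) p.K (settingOfRecord₁₃ F N θ.toStage13Params p) (θ.rzAt p s') s' (u p θ.τ9.M) (fun _ => ∅, fun _ => 0) (e p)).action23 1
            (UbgOfRecord₁₃CoP F N θ.toStage13Params p 1 s' (fun j => ((baseCfg (V := FluctV N) 1 V) j).1)))) ∧
      ∀ (p : B12.RunParams) (s' : SeqOfRecord F θ'.ν θ'.τ9.M (gOfRecord₁₃ F N θ'.toStage13Params p) p.K 1), s'.Ω 1 = Set.univ → s'.Λ 1 = Set.univ →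
        ∀ V : GaugeField (F.P p.K) 1 (SU N),
          slotsTOfRecord F N θ'.ν θ'.τ9 (EOfRecord₁₃ F N θ'.toStage13Params) (wOfRecord₉ F N θ'.toStage9Params) θ'.ppSel p (gOfRecord₁₃ F N θ'.toStage13Params p) 1 s' V =
            sect2Slot F N (FluctV N) p.K (settingOfRecord₁₃ F N θ'.toStage13Params p) (θ'.rzAt p s') (WtOfRecord₁₃H F N θ' p s') s' (u p θ'.τ9.M) (e p)
              (UbgOfRecord₁₃CoP F N θ'.toStage13Params p 1 s') V := by
  classical
  -- the value profile per run (through the unique top history of length `1`, if any)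
  let v : (p : B12.RunParams) → GaugeField (F.P p.K) 1 (SU N) → ℝ := fun p V =>
    if h : ∃ s : SeqOfRecord F θ.ν θ.τ9.M (gOfRecord₁₃ F N θ.toStage13Params p) p.K 1, s.Ω 1 = Set.univ ∧ s.Λ 1 = Set.univ then
      slotsTOfRecord F N θ.ν θ.τ9 (EOfRecord₁₃ F N θ.toStage13Params) (wOfRecord₉ F N θ.toStage9Params) θ.ppSel p (gOfRecord₁₃ F N θ.toStage13Params p) 1 h.choose V *
        Real.exp ((1 / 2 : ℝ) * (θ.Zh p 1 h.choose.Ω h.choose.Λ).quad 0 Set.univ (baseCfg (V := FluctV N) 1 V)) *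
        Real.exp (-(sect2ActionDataOfRecord F N (FluctV N) p.K (settingOfRecord₁₃ F N θ.toStage13Params p) (θ.rzAt p h.choose) h.choose (u p θ.τ9.M) (fun _ => ∅, fun _ => 0)
          (e p)).action23 1 (UbgOfRecord₁₃CoP F N θ.toStage13Params p 1 h.choose (fun j => ((baseCfg (V := FluctV N) 1 V) j).1)))
    else 0
  let Ztop : (p : B12.RunParams) → ℕ → (ℕ → Set (Site (F.P p.K) 0)) → (ℕ → Set (Site (F.P p.K) 0)) → TkResidualW F N (FluctV N) p.K := fun p n Ω Λ =>
    ⟨fun j Y ω => match j with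
        | 0 => Set.indicator {∅} (fun _ => v p (ω 1).1) Y + Set.indicator {Set.univ} (fun _ => 1 - v p (ω 1).1) Y
        | j + 1 => (θ.Zh p n Ω Λ).ζ0 (j + 1) Y ω,
      (θ.Zh p n Ω Λ).quad⟩
  let Zh' : (p : B12.RunParams) → ℕ → (ℕ → Set (Site (F.P p.K) 0)) → (ℕ → Set (Site (F.P p.K) 0)) → TkResidualW F N (FluctV N) p.K :=
    fun p n Ω Λ => if n = 1 ∧ Ω 1 = Set.univ ∧ Λ 1 = Set.univ then Ztop p n Ω Λ else θ.Zh p n Ω Λ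
  have hZoff : ∀ p n Ω Λ, ¬ (n = 1 ∧ Ω 1 = Set.univ ∧ Λ 1 = Set.univ) → Zh' p n Ω Λ = θ.Zh p n Ω Λ := fun p n Ω Λ hnot => if_neg hnot
  have hZtop : ∀ p n Ω Λ, (n = 1 ∧ Ω 1 = Set.univ ∧ Λ 1 = Set.univ) → Zh' p n Ω Λ = Ztop p n Ω Λ := fun p n Ω Λ htop => if_pos htop
  let θ' : Stage13HParams F N := { θ with Zh := Zh' }
  have hS : ∀ p n Ω Λ j Y ω, (θ'.Zh p n Ω Λ).ζ0 (j + 1) Y ω = (θ.Zh p n Ω Λ).ζ0 (j + 1) Y ω := fun p n Ω Λ j Y ω => by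
    show (Zh' p n Ω Λ).ζ0 (j + 1) Y ω = _
    by_cases htop : n = 1 ∧ Ω 1 = Set.univ ∧ Λ 1 = Set.univ
    · rw [hZtop p n Ω Λ htop]
    · rw [hZoff p n Ω Λ htop]
  have hQ : ∀ p n Ω Λ j Λ' ω, (θ'.Zh p n Ω Λ).quad j Λ' ω = (θ.Zh p n Ω Λ).quad j Λ' ω := fun p n Ω Λ j Λ' ω => by
    show (Zh' p n Ω Λ).quad j Λ' ω = _
    by_cases htop : n = 1 ∧ Ω 1 = Set.univ ∧ Λ 1 = Set.univ
    · rw [hZtop p n Ω Λ htop]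
    · rw [hZoff p n Ω Λ htop]
  have h0 : ∀ p n Ω Λ, (n = 1 ∧ Ω 1 = Set.univ ∧ Λ 1 = Set.univ) → ∀ Y ω, (θ'.Zh p n Ω Λ).ζ0 0 Y ω =
      Set.indicator {∅} (fun _ => v p (ω 1).1) Y + Set.indicator {Set.univ} (fun _ => 1 - v p (ω 1).1) Y := fun p n Ω Λ htop Y ω => by
    show (Zh' p n Ω Λ).ζ0 0 Y ω = _
    rw [hZtop p n Ω Λ htop]
  have hvs : ∀ (p : B12.RunParams) (s' : SeqOfRecord F θ.ν θ.τ9.M (gOfRecord₁₃ F N θ.toStage13Params p) p.K 1), s'.Ω 1 = Set.univ → s'.Λ 1 = Set.univ → ∀ V,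
      v p V = slotsTOfRecord F N θ.ν θ.τ9 (EOfRecord₁₃ F N θ.toStage13Params) (wOfRecord₉ F N θ.toStage9Params) θ.ppSel p (gOfRecord₁₃ F N θ.toStage13Params p) 1 s' V *
        Real.exp ((1 / 2 : ℝ) * (θ.Zh p 1 s'.Ω s'.Λ).quad 0 Set.univ (baseCfg (V := FluctV N) 1 V)) *
        Real.exp (-(sect2ActionDataOfRecord F N (FluctV N) p.K (settingOfRecord₁₃ F N θ.toStage13Params p) (θ.rzAt p s') s' (u p θ.τ9.M) (fun _ => ∅, fun _ => 0) (e p)).action23 1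
          (UbgOfRecord₁₃CoP F N θ.toStage13Params p 1 s' (fun j => ((baseCfg (V := FluctV N) 1 V) j).1))) := by
    intro p s' hΩ hΛ V
    have hex : ∃ s : SeqOfRecord F θ.ν θ.τ9.M (gOfRecord₁₃ F N θ.toStage13Params p) p.K 1, s.Ω 1 = Set.univ ∧ s.Λ 1 = Set.univ := ⟨s', hΩ, hΛ⟩
    have hch : hex.choose = s' := seq_top_unique _ _ hex.choose_spec.1 hex.choose_spec.2 hΩ hΛ
    show (if h : ∃ s : SeqOfRecord F θ.ν θ.τ9.M (gOfRecord₁₃ F N θ.toStage13Params p) p.K 1, s.Ω 1 = Set.univ ∧ s.Λ 1 = Set.univ then _ else 0) = _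
    rw [dif_pos hex, hch]
  refine ⟨v, θ', rfl, rfl, hZoff, hQ, zhLocal_of_valueRepin hZoff hS h0, zhUnity_of_valueRepin hZoff hS h0, fun hv => zhLaws_of_valueRepin hZoff hS h0 hv, hvs,
    fun p s' hΩ hΛ V => ?_⟩
  have hb : (fun j => ((baseCfg (V := FluctV N) 1 V) j).1) 1 = V := funext fun b => baseCfg_fst_self (V := FluctV N) 1 V b
  have hζ : ∀ Y ω, (θ'.Zh p 1 s'.Ω s'.Λ).ζ0 0 Y ω =
      (fun Y' (W : GaugeField (F.P p.K) 1 (SU N)) => Set.indicator {∅} (fun _ => v p W) Y' + Set.indicator {Set.univ} (fun _ => 1 - v p W) Y') Y (ω 1).1 :=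
    h0 p 1 s'.Ω s'.Λ ⟨rfl, hΩ, hΛ⟩
  refine slotsT_top_pair_eq_sect2Slot_of_value θ' p s' hΩ hΛ (u p θ.τ9.M) (e p)
    (g := fun Y' (W : GaugeField (F.P p.K) 1 (SU N)) => Set.indicator {∅} (fun _ => v p W) Y' + Set.indicator {Set.univ} (fun _ => 1 - v p W) Y') hζ V ?_
  show Set.indicator {∅} (fun _ => v p V) ∅ + Set.indicator {Set.univ} (fun _ => 1 - v p V) ∅ = _
  rw [Set.indicator_of_mem (Set.mem_singleton _), Set.indicator_of_notMem (fun h => Set.empty_ne_univ (Set.mem_singleton_iff.1 h)), add_zero, hvs p s' hΩ hΛ V, hQ]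
  rfl

/-- ★★★★★ **INSIDE K1⁹'s HYPOTHESIS CLASS, GIVEN THE RANGE INEQUALITY**: from any `θ` with K1⁹'s four hypothesis-side conjuncts, the value re-pin `θ′` (same `Stage13RParams`, `Phih`,
`quad`; non-top histories unchanged) keeps `ZhUnity`, `SlotsNondegenerate₁₃`, `Admissible` outright and `Provisos₁₃SepCoPH` as soon as the value profile lies in `[0, 1]` — and at `θ′` the
top-pair identity holds at every coarse field for the prescribed terms, `quad` untouched.  So (q1) (a law on `quad`) leaves the top-pair conjunct as free as before; only VALUE pins of
`ζ0` (K0b) and `quad` (C2) together make it contentful.  LOCATED; nothing of Bałaban asserted or refuted; K1⁹'s `∃θ` neither advanced nor refuted.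
[cite: Balaban1988Convergent, Thm 1 p.262, (2.18) p.257, (2.21)–(2.23) p.258, (3.2)–(3.9) pp.265–266, (3.16)–(3.20) pp.268–269, (3.25) p.270] -/
theorem exists_zh_top_pair_identity_by_value_of_hypotheses (θ : Stage13HParams F N) (hP : θ.Provisos₁₃SepCoPH F N) (hU : θ.ZhUnity)
    (hS' : θ.SlotsNondegenerate₁₃ F N) (hA : θ.Admissible F N)
    (u : (p : B12.RunParams) → (M : ℕ) → Sect2.TermValues (F.P p.K) (MatA N) (FluctV N) M) (e : B12.RunParams → ℝ) :
    ∃ (v : (p : B12.RunParams) → GaugeField (F.P p.K) 1 (SU N) → ℝ) (θ' : Stage13HParams F N), θ'.toStage13RParams = θ.toStage13RParams ∧ θ'.Phih = θ.Phih ∧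
      (∀ p n Ω Λ, ¬ (n = 1 ∧ Ω 1 = Set.univ ∧ Λ 1 = Set.univ) → θ'.Zh p n Ω Λ = θ.Zh p n Ω Λ) ∧
      (∀ p n Ω Λ j Λ' ω, (θ'.Zh p n Ω Λ).quad j Λ' ω = (θ.Zh p n Ω Λ).quad j Λ' ω) ∧
      (θ'.ZhUnity ∧ θ'.SlotsNondegenerate₁₃ F N) ∧ θ'.Admissible F N ∧
      ((∀ p V, 0 ≤ v p V ∧ v p V ≤ 1) → θ'.Provisos₁₃SepCoPH F N) ∧
      (∀ (p : B12.RunParams) (s' : SeqOfRecord F θ.ν θ.τ9.M (gOfRecord₁₃ F N θ.toStage13Params p) p.K 1), s'.Ω 1 = Set.univ → s'.Λ 1 = Set.univ → ∀ V : GaugeField (F.P p.K) 1 (SU N),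
        v p V = slotsTOfRecord F N θ.ν θ.τ9 (EOfRecord₁₃ F N θ.toStage13Params) (wOfRecord₉ F N θ.toStage9Params) θ.ppSel p (gOfRecord₁₃ F N θ.toStage13Params p) 1 s' V *
          Real.exp ((1 / 2 : ℝ) * (θ.Zh p 1 s'.Ω s'.Λ).quad 0 Set.univ (baseCfg (V := FluctV N) 1 V)) *
          Real.exp (-(sect2ActionDataOfRecord F N (FluctV N) p.K (settingOfRecord₁₃ F N θ.toStage13Params p) (θ.rzAt p s') s' (u p θ.τ9.M) (fun _ => ∅, fun _ => 0) (e p)).action23 1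
            (UbgOfRecord₁₃CoP F N θ.toStage13Params p 1 s' (fun j => ((baseCfg (V := FluctV N) 1 V) j).1)))) ∧
      ∀ (p : B12.RunParams) (s' : SeqOfRecord F θ'.ν θ'.τ9.M (gOfRecord₁₃ F N θ'.toStage13Params p) p.K 1), s'.Ω 1 = Set.univ → s'.Λ 1 = Set.univ →
        ∀ V : GaugeField (F.P p.K) 1 (SU N),
          slotsTOfRecord F N θ'.ν θ'.τ9 (EOfRecord₁₃ F N θ'.toStage13Params) (wOfRecord₉ F N θ'.toStage9Params) θ'.ppSel p (gOfRecord₁₃ F N θ'.toStage13Params p) 1 s' V =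
            sect2Slot F N (FluctV N) p.K (settingOfRecord₁₃ F N θ'.toStage13Params p) (θ'.rzAt p s') (WtOfRecord₁₃H F N θ' p s') s' (u p θ'.τ9.M) (e p)
              (UbgOfRecord₁₃CoP F N θ'.toStage13Params p 1 s') V := by
  obtain ⟨v, θ', h1, h2, hoff, hQ, hloc, hun, hlaws, hvs, hid⟩ := exists_zh_top_pair_identity_by_value θ u e
  exact ⟨v, θ', h1, h2, hoff, hQ, ⟨hun hU, slotsNondegenerate₁₃_of_sameR h1 hS'⟩, admissible_of_sameR h1 hA,
    fun hv => provisos₁₃SepCoPH_of_sameR h1 hP (hlaws hv hP.zhLaws) (hloc hP.zhLocal), hvs, hid⟩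

end Inhabited

end Summit.QuantumFields.YangMills.Theorems.BalabanUVNodesN11TopPairZetaValueDial

end
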